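import Summits.CriticalPhenomena.CardyFormulaZ2.Theorems.CardyComplexConeParafermionToSLESixFamiliesFaceKernelInnerNearCompact
import Summits.CriticalPhenomena.CardyFormulaZ2.Theorems.CardyComplexConeParafermionToSLESixFamiliesFaceKernelWPathConnected
import Summits.CriticalPhenomena.CardyFormulaZ2.Theorems.CardyComplexConeParafermionToSLESixFamiliesFaceKernelEastMarch
import Summits.CriticalPhenomena.CardyFormulaZ2.Theorems.CardyComplexConeParafermionToSLESixFamiliesFaceKernelVertexNear
import Summits.CriticalPhenomena.CardyFormulaZ2.Theorems.CardyComplexConeParafermionToSLESixFamiliesFaceKernelPercFaceK1Of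
import Summits.CriticalPhenomena.CardyFormulaZ2.Theorems.CardyComplexConeParafermionToSLESixFamiliesOfSlitMartingaleData
import HarnessLib

/-!
# Line `face-kernel-k1` (lead c4) for the crux `ParafermionToSLESixFamilies` — skeleton r1

Route `CardyComplexCone` (sub-problem `CriticalPhenomena/CardyFormulaZ2`), crux
`Summit.CriticalPhenomena.CardyFormulaZ2.Theses.CardyComplexCone.ParafermionToSLESixFamilies`
(item stmt-CriticalPhenomena-11389). Skeleton of lead c4, revision r1 (after integration).

Composition (landed reductions only):
`PercFaceK1 → PercFaceBoxTight → PercKSBoxData` (`percKSBoxData_of_K1`, p94109) and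
`PercKSBoxData → PercParaApprox → crux` (`parafermionToSLESixFamilies_of_percData`, p127450).

r0 → r1: the five (K1) stubs are LANDED theorems of the tree and are imported, not restated:
`stub_isInnerFace_near_compact` (p128459, `…FaceKernelInnerNearCompact.lean`),
`stub_W_eq_of_isPathConnected` (p128602, `…FaceKernelWPathConnected.lean`),
`stub_exists_isOutEdge_east` (p128695, `…FaceKernelEastMarch.lean`),
`stub_exists_vertex_near` (p128731, `…FaceKernelVertexNear.lean`),
`stub_percFaceK1_of` (p129369, `…FaceKernelPercFaceK1Of.lean`; glue p129243 / p129244 / p129248);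
so (K1) `PercFaceK1` holds (`percFaceK1_holds` below; landed by name as `percFaceK1` in
`…FaceKernelPercFaceK1.lean`). The two remaining stubs are the crux's research inputs and are NOT
expected to close in this line: `stub_percFaceBoxTight` (Kemppainen–Smirnov box tightness of the
raw, self-touching medial exploration polyline from Condition G2 / RSW — needs a transfer statement
for non-simple lattice curves, cf. `KSRegularityOfConditionG2.lean` note 4) and
`stub_percParaApprox` (identification N + I and slit/pin uniformity U: the research content of the
crux, `Cruxes/ParafermionToSLESixFamilies/VERDICT-lead-c3.md`; the death point of line
`caratheodory-net-slit-uniformity`).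
-/

noncomputable section

open Summit.CriticalPhenomena.CardyFormulaZ2.Cruxes.ParafermionToSLESixFamilies.CaratheodoryNetSlitUniformity

namespace Summit.CriticalPhenomena.CardyFormulaZ2.Cruxes.ParafermionToSLESixFamilies.FaceKernel

/-- **(K1) holds** (sorry-free): the assembly stub fed with the four landed stubs. -/
theorem percFaceK1_holds : PercFaceK1 :=
  stub_percFaceK1_of stub_isInnerFace_near_compact stub_W_eq_of_isPathConnected
    stub_exists_isOutEdge_east stub_exists_vertex_near

/-- **Research stub (held by the lead; not expected to close in this line).** Kemppainen–Smirnov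
box tightness of the bond interfaces read through the uniformizers of the oriented face domains
(Condition G2 from RSW on `ℤ²`, for the raw non-simple medial exploration polyline). -/
theorem stub_percFaceBoxTight : PercFaceBoxTight := by
  sorry

/-- **Research stub (held by the lead; not expected to close in this line).** The slit-observable
martingale approximation: identification (N + I) and slit/pin uniformity (U) — the research
content of the crux (`VERDICT-lead-c3.md`). -/
theorem stub_percParaApprox : PercParaApprox := by
  sorry

/-- **Glue.** The crux from the two research stubs, (K1) being proved:
`percKSBoxData_of_K1` and `parafermionToSLESixFamilies_of_percData`. -/
theorem ParafermionToSLESixFamilies_of (hBT : PercFaceBoxTight) (hPA : PercParaApprox) :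
    Summit.CriticalPhenomena.CardyFormulaZ2.Theses.CardyComplexCone.ParafermionToSLESixFamilies :=
  parafermionToSLESixFamilies_of_percData (percKSBoxData_of_K1 percFaceK1_holds hBT) hPA

/-- **The crux, modulo the two research stubs.** -/
theorem ParafermionToSLESixFamilies_proof :
    Summit.CriticalPhenomena.CardyFormulaZ2.Theses.CardyComplexCone.ParafermionToSLESixFamilies :=
  ParafermionToSLESixFamilies_of stub_percFaceBoxTight stub_percParaApprox

end Summit.CriticalPhenomena.CardyFormulaZ2.Cruxes.ParafermionToSLESixFamilies.FaceKernel

end
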